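import Summits.MatrixMultiplication.MatrixMultiplication.Theorems.SoloInformedSkewDoor
import Summits.MatrixMultiplication.MatrixMultiplication.Theorems.AsymptoticRankCWSkewPairRanges
import Mathlib.LinearAlgebra.CrossProduct
import Mathlib.Algebra.Lie.Sl2

/-!
# The skew door is the `𝔰𝔩₂` door: `ω = 2 ⟸ R̃(structure tensor of 𝔰𝔩₂(ℂ)) = 3`

The skew little Coppersmith–Winograd tensor `T_{skewcw,2}` is, up to `GL₃(ℂ)^{×3}`, the Levi-Civita
tensor `ε = a₀ ∧ a₁ ∧ a₂` (CGLV 2022, §3.2; in the tree: `cglv_exists_basis_skewCwTensor_one`,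
`asymptoticRank_leviCivita_eq_skewCwTensor`). This file records two classical names of `ε` that
do not appear in the matrix-multiplication literature and under which the door
"`R̃ = 3 ⇒ ω = 2`" (door D1′, `matrixMultiplication_of_asymptoticRank_skewCwTensor_one_le_three`)
can therefore be searched and attacked:

* `ε` is the structure tensor of the **cross product** on `ℂ³` (Mathlib's `crossProduct`), i.e. of
  the Lie algebra `𝔰𝔬₃(ℂ)` in its standard basis (`bilinStructureTensor_crossProduct`);
* `ε` is `GL₃^{×3}`-equivalent to the structure tensor of **`𝔰𝔩₂(ℂ)`** in a standard basis
  `(e, h, f)` — indeed of ANY `𝔰𝔩₂`-triple spanning a Lie algebra with that basis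
  (`lieStructureTensor_eq_slTwo_of_isSl2Triple`, `leviCivita_restrictsTo_slTwo`,
  `slTwo_restrictsTo_leviCivita`): the change of basis is `(1, 1, C)` with
  `C = -(2 e₀₂ + e₁₁ + 2 e₂₀)` on the output leg (the Killing-form identification `𝔰𝔩₂ ≅ 𝔰𝔩₂^*`
  followed by `e ↔ f`).

Consequences (all ranks transported along the two restrictions):
`R̃(𝔰𝔩₂) = R̃(T_{skewcw,2}) ∈ [3, √17]` (`asymptoticRank_slTwo_eq_skewCwTensor`,
`asymptoticRank_slTwo_mem_Icc`), and the doors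
`asymptoticRank slTwoStructureTensor ≤ 3 → MatrixMultiplication`,
`asymptoticRank (bilinStructureTensor crossProduct) ≤ 3 → MatrixMultiplication`, and, for every
complex Lie algebra `L` with a basis `b : Fin 3 → L` forming an `𝔰𝔩₂`-triple `(h, e, f) = (b 1, b 0, b 2)`,
`asymptoticRank (lieStructureTensor b) ≤ 3 → MatrixMultiplication`.

So the summit follows from: *the Lie bracket of the smallest simple complex Lie algebra has minimal
asymptotic rank*. (The bracket of `𝔤𝔩_n` has exponent `ω` classically; the point here is the fixed
size `n = 2` and the asymptotic rank, not the rank, of its `3 × 3 × 3` structure tensor, whose rank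
and border rank are `5`.)

References: A. Conner, F. Gesmundo, J. M. Landsberg, E. Ventura, *Rank and border rank of
Kronecker powers of tensors and Strassen's laser method*, comput. complexity 31 (2022), §2.2, §3.2
(arXiv:1909.04785); N. Bourbaki, *Lie Groups and Lie Algebras*, Ch. VIII §1 (`𝔰𝔩₂`-triples).
-/

set_option linter.dupNamespace false

noncomputable section

namespace Summit.MatrixMultiplication.MatrixMultiplication.Theorems

open Module
open scoped Matrix
open Literature.Computability.AlgebraicComplexity

/-! ## Structure tensors -/

/-- The structure tensor of a bilinear map `m` on `K³` in the standard basis: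
`T i j k = (m eᵢ eⱼ)_k`. [folklore] -/
def bilinStructureTensor {K : Type} [CommRing K]
    (m : (Fin 3 → K) →ₗ[K] (Fin 3 → K) →ₗ[K] (Fin 3 → K)) : Fin 3 → Fin 3 → Fin 3 → K :=
  fun i j k => m (Pi.single i 1) (Pi.single j 1) k

/-- The structure tensor of a Lie algebra `L` with respect to a basis `b` indexed by `ι`:
`T i j k = ` the `k`-th coordinate of `⁅b i, b j⁆`. [folklore] -/
def lieStructureTensor {K : Type} [CommRing K] {L : Type*} [LieRing L] [LieAlgebra K L]
    {ι : Type} (b : Basis ι K L) : ι → ι → ι → K :=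
  fun i j k => b.repr ⁅b i, b j⁆ k

/-- The structure constants of `𝔰𝔩₂` in a standard basis `(e, h, f) = (0, 1, 2)` as an integer
table: `[h,e] = 2e`, `[e,h] = -2e`, `[e,f] = h`, `[f,e] = -h`, `[h,f] = -2f`, `[f,h] = 2f`.
[folklore] -/
def slTwoTable : Fin 3 → Fin 3 → Fin 3 → ℤ :=
  ![![![0, 0, 0], ![-2, 0, 0], ![0, 1, 0]],
    ![![2, 0, 0], ![0, 0, 0], ![0, 0, -2]],
    ![![0, -1, 0], ![0, 0, 2], ![0, 0, 0]]]

/-- The structure tensor of `𝔰𝔩₂(ℂ)` in a standard basis `(e, h, f)`. [folklore] -/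
def slTwoStructureTensor : Fin 3 → Fin 3 → Fin 3 → ℂ := fun i j k => (slTwoTable i j k : ℂ)

/-- **The cross product has structure tensor `ε`**: `(eᵢ × eⱼ)_k = ε_{ijk}`. [folklore] -/
theorem bilinStructureTensor_crossProduct :
    bilinStructureTensor (crossProduct (R := ℂ)) = fun i j k => ((leviCivita3 i j k : ℤ) : ℂ) := by
  funext i j k
  rw [leviCivita3_eq_table]
  fin_cases i <;> fin_cases j <;> fin_cases k <;>
    simp [bilinStructureTensor, cross_apply, leviCivita3Table]

/-- **Any `𝔰𝔩₂`-triple has the structure constants of `slTwoTable`**: if `b` is a basis of a complex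
Lie algebra indexed by `Fin 3` with `(h, e, f) = (b 1, b 0, b 2)` an `𝔰𝔩₂`-triple, then the structure
tensor of `L` in the basis `b` is `slTwoStructureTensor`. [folklore] -/
theorem lieStructureTensor_eq_slTwo_of_isSl2Triple {L : Type*} [LieRing L] [LieAlgebra ℂ L]
    (b : Basis (Fin 3) ℂ L) (ht : IsSl2Triple (b 1) (b 0) (b 2)) :
    lieStructureTensor b = slTwoStructureTensor := by
  have h10 : ⁅b 1, b 0⁆ = (2 : ℂ) • b 0 := by
    rw [ht.lie_h_e_nsmul, ← Nat.cast_smul_eq_nsmul ℂ]; norm_num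
  have h12 : ⁅b 1, b 2⁆ = (-2 : ℂ) • b 2 := by
    rw [ht.lie_h_f_nsmul, ← Nat.cast_smul_eq_nsmul ℂ, ← neg_smul]; norm_num
  have h02 : ⁅b 0, b 2⁆ = b 1 := ht.lie_e_f
  have h01 : ⁅b 0, b 1⁆ = (-2 : ℂ) • b 0 := by
    rw [← lie_skew, h10, ← neg_smul]
  have h21 : ⁅b 2, b 1⁆ = (2 : ℂ) • b 2 := by
    rw [← lie_skew, h12, ← neg_smul]; norm_num
  have h20 : ⁅b 2, b 0⁆ = (-1 : ℂ) • b 1 := by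
    rw [← lie_skew, h02]; simp
  funext i j k
  fin_cases i <;> fin_cases j <;> fin_cases k <;>
    simp [lieStructureTensor, slTwoStructureTensor, slTwoTable, h10, h12, h02, h01, h21, h20]

/-! ## `𝔰𝔩₂ ≅ ε` as tensors -/

/-- **`ε ≥ 𝔰𝔩₂`**: `slTwo(i,j,k) = ∑_{k'} C k k' ε(i,j,k')` with `C = -(2e₀₂ + e₁₁ + 2e₂₀)`
(`A = B = 1`). [folklore] -/
theorem leviCivita_restrictsTo_slTwo :
    TensorRestrictsTo (fun a b c : Fin 3 => ((leviCivita3 a b c : ℤ) : ℂ)) slTwoStructureTensor := by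
  refine ⟨(1 : Matrix (Fin 3) (Fin 3) ℂ), (1 : Matrix (Fin 3) (Fin 3) ℂ),
    !![0, 0, -2; 0, -1, 0; -2, 0, 0], fun i j k => ?_⟩
  fin_cases i <;> fin_cases j <;> fin_cases k <;>
    simp [Fin.sum_univ_three, slTwoStructureTensor, slTwoTable, leviCivita3_eq_table,
      leviCivita3Table, Matrix.one_apply]

/-- **`𝔰𝔩₂ ≥ ε`**: the inverse change of basis `C⁻¹ = -(½e₀₂ + e₁₁ + ½e₂₀)`. [folklore] -/
theorem slTwo_restrictsTo_leviCivita :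
    TensorRestrictsTo slTwoStructureTensor (fun a b c : Fin 3 => ((leviCivita3 a b c : ℤ) : ℂ)) := by
  refine ⟨(1 : Matrix (Fin 3) (Fin 3) ℂ), (1 : Matrix (Fin 3) (Fin 3) ℂ),
    !![0, 0, -(1/2 : ℂ); 0, -1, 0; -(1/2 : ℂ), 0, 0], fun i j k => ?_⟩
  fin_cases i <;> fin_cases j <;> fin_cases k <;>
    simp [Fin.sum_univ_three, slTwoStructureTensor, slTwoTable, leviCivita3_eq_table,
      leviCivita3Table, Matrix.one_apply]

/-- **`T_{skewcw,2} ≥ 𝔰𝔩₂`** (through `ε`). [cite: ConnerGesmundoLandsbergVentura2022, §3.2] -/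
theorem skewCwTensor_restrictsTo_slTwo :
    TensorRestrictsTo (skewCwTensor ℂ 1) slTwoStructureTensor := by
  have h := skewCwTensor_restrictsTo_leviCivita
  rw [leviCivitaInline_eq_cast] at h
  exact h.trans leviCivita_restrictsTo_slTwo

/-- **`𝔰𝔩₂ ≥ T_{skewcw,2}`** (through `ε`). [cite: ConnerGesmundoLandsbergVentura2022, §3.2] -/
theorem slTwo_restrictsTo_skewCwTensor :
    TensorRestrictsTo slTwoStructureTensor (skewCwTensor ℂ 1) := by
  have h := leviCivita_restrictsTo_skewCwTensor
  rw [leviCivitaInline_eq_cast] at h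
  exact slTwo_restrictsTo_leviCivita.trans h

/-- **`R̃(𝔰𝔩₂) = R̃(T_{skewcw,2})`**. [cite: ConnerGesmundoLandsbergVentura2022, §2.2, §3.2] -/
theorem asymptoticRank_slTwo_eq_skewCwTensor :
    asymptoticRank slTwoStructureTensor = asymptoticRank (skewCwTensor ℂ 1) :=
  asymptoticRank_eq_of_restrictsTo skewCwTensor_restrictsTo_slTwo slTwo_restrictsTo_skewCwTensor

/-- **`R̃(cross product) = R̃(T_{skewcw,2})`**. [cite: ConnerGesmundoLandsbergVentura2022, §3.2] -/
theorem asymptoticRank_crossProduct_eq_skewCwTensor :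
    asymptoticRank (bilinStructureTensor (crossProduct (R := ℂ))) =
      asymptoticRank (skewCwTensor ℂ 1) := by
  rw [bilinStructureTensor_crossProduct, ← leviCivitaInline_eq_cast]
  exact asymptoticRank_leviCivita_eq_skewCwTensor

/-- **The `𝔰𝔩₂` window**: `3 ≤ R̃(𝔰𝔩₂) ≤ √17` (the skew window transported).
[cite: ConnerGesmundoLandsbergVentura2022, §2.2, Lemma 2.4] -/
theorem asymptoticRank_slTwo_mem_Icc :
    asymptoticRank slTwoStructureTensor ∈ Set.Icc (3 : ℝ) (Real.sqrt 17) := by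
  rw [asymptoticRank_slTwo_eq_skewCwTensor]
  exact asymptoticRank_skewCwTensor_one_mem_Icc

/-- `bR(𝔰𝔩₂) = 5`: the structure tensor of `𝔰𝔩₂(ℂ)` has border rank `5` (transported from
`bR(T_{skewcw,2}) = 5`, CGLV Prop. 3.1). [cite: ConnerGesmundoLandsbergVentura2022, Prop. 3.1] -/
theorem algBorderRank_slTwo_eq_five : algBorderRank slTwoStructureTensor = 5 := by
  rw [← algBorderRank_skewCwTensor_one_eq_five]
  exact le_antisymm skewCwTensor_restrictsTo_slTwo.algBorderRank_le
    slTwo_restrictsTo_skewCwTensor.algBorderRank_le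

/-! ## The doors -/

/-- **The `𝔰𝔩₂` door**: if the structure tensor of `𝔰𝔩₂(ℂ)` has asymptotic rank at most `3`
(i.e. equal to `3`), then `ω = 2`. [cite: ConnerGesmundoLandsbergVentura2022, §2.2] -/
theorem matrixMultiplication_of_asymptoticRank_slTwo_le_three
    (h : asymptoticRank slTwoStructureTensor ≤ 3) : _root_.MatrixMultiplication :=
  matrixMultiplication_of_asymptoticRank_skewCwTensor_one_le_three
    (asymptoticRank_slTwo_eq_skewCwTensor ▸ h)

/-- **The cross-product door** (`𝔰𝔬₃(ℂ)`): if the structure tensor of the cross product on `ℂ³`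
has asymptotic rank at most `3`, then `ω = 2`. [cite: ConnerGesmundoLandsbergVentura2022, §2.2] -/
theorem matrixMultiplication_of_asymptoticRank_crossProduct_le_three
    (h : asymptoticRank (bilinStructureTensor (crossProduct (R := ℂ))) ≤ 3) :
    _root_.MatrixMultiplication :=
  matrixMultiplication_of_asymptoticRank_skewCwTensor_one_le_three
    (asymptoticRank_crossProduct_eq_skewCwTensor ▸ h)

/-- **The `𝔰𝔩₂`-triple door, basis-free form**: for every complex Lie algebra `L` with a basis
`b : Fin 3 → L` such that `(b 1, b 0, b 2)` is an `𝔰𝔩₂`-triple, minimal asymptotic rank of the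
structure tensor of `L` in that basis implies `ω = 2`. [cite: ConnerGesmundoLandsbergVentura2022, §2.2] -/
theorem matrixMultiplication_of_isSl2Triple {L : Type*} [LieRing L] [LieAlgebra ℂ L]
    (b : Basis (Fin 3) ℂ L) (ht : IsSl2Triple (b 1) (b 0) (b 2))
    (h : asymptoticRank (lieStructureTensor b) ≤ 3) : _root_.MatrixMultiplication :=
  matrixMultiplication_of_asymptoticRank_slTwo_le_three
    (lieStructureTensor_eq_slTwo_of_isSl2Triple b ht ▸ h)

/-- The `𝔰𝔩₂` door is again a certificate statement: `R̃(𝔰𝔩₂) ≤ 3` iff for every `ε > 0` some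
Kronecker power of `T_{skewcw,2}` has a border-rank certificate `bR ≤ (3+ε)^n`.
[cite: ConnerGesmundoLandsbergVentura2022, §2.2] -/
theorem asymptoticRank_slTwo_le_three_iff_certificates :
    asymptoticRank slTwoStructureTensor ≤ 3 ↔
      ∀ ε : ℝ, 0 < ε → ∃ n : ℕ, 0 < n ∧
        (algBorderRank (kroneckerPow (skewCwTensor ℂ 1) n) : ℝ) ≤ (3 + ε) ^ n := by
  rw [asymptoticRank_slTwo_eq_skewCwTensor]
  exact asymptoticRank_skewCwTensor_one_le_three_iff_certificates

end Summit.MatrixMultiplication.MatrixMultiplication.Theorems
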